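import Mathlib
import HarnessLib
import HarnessLib.Audit
import Summits.KontsevichZagierPeriods.Statement

/-!
Route: TorsionLogsGKZ

CLOSED (retired) 2026-08-15T13:48:38Z by operator:999:1257524 — reason: not-a-thesis: assembly does not conclude the sub-problem Statement — note: D-0027 §2.1 audit (human 2026-08-15: routes that do not decide the summit are removed): the assembly concludes `FirstPairs`, not the sub-problem statement; a NEW conforming route may be opened from the same idea (generated `closes : … → _root_.KontsevichZagierPeriods`).. The file is kept as the record of this route; refuted decls are indexed as negative knowledge (`ledger negatives`).

# Route TorsionLogsGKZ — torsion certificates compile to logarithms; Gross–Kohnen–Zagier CM values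
are the mixed test family

TORSION EXTENSIONS COMPILE TO LOGARITHMS (realises card torsion-extensions-compile-to-logs-gkz). A
mixed period ∫_Γ ω — Γ a
ℚ-semialgebraic chain on X(ℂ) with algebraic boundary cycle Z = ∂Γ, ω algebraic with log poles along
a cycle W — is "log of an
algebraic number + pure period" as soon as Z and W are TORSION in the Chow group, and the witnesses
(rational functions f with
N·Z = Σ div f) are exactly what rules (2)/(3) consume: d log f is algebraic, log|f| is the 1-dim
representation ∫dt/t and never a
primitive. X (sector): the H21 calculus derives every such identity from the certificate
(RationalEquivalenceActsByMoves, filed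
informal), tested on the family where these identities are famous and, since BruinierLiYang2025 (Thm
1.4), THEOREMS: the
Gross–Kohnen–Zagier CM values of higher Green functions G_{k,f}(z₁,z₂) = |d₁d₂|^{-r/2} κ⁻¹ log|α|
(Zhang1997: archimedean heights
of CM cycles on Kuga–Sato varieties; Zhou2015: explicit Kontsevich–Zagier integral representations).
Layer 1, typed now:
X₁ := FirstPairs = ModelTorsionPair ∧ GKZLevelOnePair ∧ GKZLevelThreePair — the two smallest
cusp-form-free weight-4 GKZ values as
explicit 3-dimensional period identities (level 1 = Mellit's case z′ = i: J₁ = 6√3·π·log(2+√3);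
level 3: J₃ = 4√3·π·log 2, from
Zhou2015 Remark 9 + Euler's integral for P_{-1/6}, P_{-1/3}) and the genus-1 calibration on y² =
x³+1 of BOTH certificate steps
(d log of the 6-torsion certificate = one change of variables; translation by the 3-torsion point =
one change of variables).
Sector route, not a route to the summit: refuting either GKZ pair refutes KontsevichZagierPeriods
(the values agree by theorems).
Lean: `(∀ (r r₁ r₂ : Literature.NumberTheory.Transcendental.KZ.IntegralRep 1), r.domain = {x | x 0 ∈
Set.Ioo (-1:ℝ) 0} → Set.EqOn r.integrand (fun x => 9 / ((2 - x 0) * Real.sqrt (x 0 ^ 3 + 1)))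
r.domain → r₁.domain = {x | x 0 ∈ Set.Ioo (1:ℝ) 2} → Set.EqOn r₁.integrand (fun x => 1 / x 0)
r₁.domain → r₂.domain = {x | -1 < x 0} → Set.EqOn r₂.integrand (fun x => 1 / Real.sqrt (x 0 ^ 3 +
1)) r₂.domain → Literature.NumberTheory.Transcendental.KZ.of r -
Literature.NumberTheory.Transcendental.KZ.of r₁ - Literature.NumberTheory.Transcendental.KZ.of r₂ ∈
Literature.NumberTheory.Transcendental.KZ.relations) ∧ (∀ (r r' :
Literature.NumberTheory.Transcendental.KZ.IntegralRep 3), r.domain = {x | ∀ i, x i ∈ Set.Ioo (0:ℝ)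
1} → Set.EqOn r.integrand (fun x => (x 0) ^ (-(1:ℝ) / 6) * (1 - x 0) ^ (-(5:ℝ) / 6) * (1 - (1 - x 2)
* x 0 / 2) ^ (-(1:ℝ) / 6) * ((x 1) ^ (-(1:ℝ) / 6) * (1 - x 1) ^ (-(5:ℝ) / 6) * (1 - (1 - x 2) * x 1
/ 2) ^ (-(1:ℝ) / 6))) r.domain → r'.domain = {x | (x 0 ^ 2 + x 1 ^ 2) ^ 2 < 108 ∧ x 2 ∈ Set.Ioo
(1:ℝ) (2 + Real.sqrt 3)} → Set.EqOn r'.integrand (fun x => 1 / x 2) r'.domain →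
Literature.NumberTheory.Transcendental.KZ.Equivalent r r') ∧ (∀ (r r' :
Literature.NumberTheory.Transcendental.KZ.IntegralRep 3), r.domain = {x | ∀ i, x i ∈ Set.Ioo (0:ℝ)
1} → Set.EqOn r.integrand (fun x => (x 0) ^ (-(1:ℝ) / 3) * (1 - x 0) ^ (-(2:ℝ) / 3) * (1 - (1 - x 2)
* x 0 / 2) ^ (-(1:ℝ) / 3) * ((x 1) ^ (-(1:ℝ) / 3) * (1 - x 1) ^ (-(2:ℝ) / 3) * (1 - (1 - x 2) * x 1
/ 2) ^ (-(1:ℝ) / 3))) r.domain → r'.domain = {x | (x 0 ^ 2 + x 1 ^ 2) ^ 2 < 48 ∧ x 2 ∈ Set.Ioo (1:ℝ)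
2} → Set.EqOn r'.integrand (fun x => 1 / x 2) r'.domain →
Literature.NumberTheory.Transcendental.KZ.Equivalent r r')`

## Assembly
Bookkeeping, provable now: FirstPairs.(b),(c) are the two crux hypotheses verbatim. FirstPairs.(a):
9/((2−x)√c) = 3·(x+1)/((2−x)√c)
+ 3/√c on (−1,0) (integrandAddRel with two auxiliary representations the prover constructs:
semialgebraic by KZSemialgebraicComplex
re_im_sqrt/div, integrable by comparison with (x+1)^{-1/2}); OneThirdPeriod turns [3/√c on (−1,0)]
into [r₂]; CertificateDlogUnfolds
(applied to the (x+1)/((2−x)√c) representation) and two more integrand-additivity moves turn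
3·[(x+1)/((2−x)√c)] into 3·[1/(3x) on (1,2)]
≡ [r₁]. The informal cruxes filed at open (RationalEquivalenceActsByMoves, rank 3;
KugaSatoCertificate, rank 5) are the MECHANISM
expected to prove ranks 2 and 4 and become their glued children (Two-layer plan); they are not
hypotheses of this assembly.

Rationale: WHY THIS LINE. Pure special-point identities come from Hodge classes; MIXED ones come from torsion
extension classes, and the calculus has a native way
to consume the witness of torsion: N·∫_Γ ω_W = ∫_δ ω_W + Σ∫_{f⁻¹(ray)} ω_W with δ a closed cycle
(pure period) and the last term a trace
down to ∫ Σ m_j dt/(t − f(W_j)) = logs — rule (2) along t = f on each branch, rule (1b) for the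
trace, log unfolded as ∫dt/t
(sources: Zhang1997 for heights of CM cycles = G_k values; GrossZagier1986 §V and
GrossKohnenZagier1987 for the conjecture;
BruinierLiYang2025 Thm 1.4 + arXiv:2106.13653 for its proof; Zhou2015 Thm 1.2.1/Prop 2.2.2/Remark 9
for the KZ representations).
Imported areas: arithmetic geometry of heights and biextensions (Bloch–Beilinson; Zhang),
automorphic forms (GKZ, Borcherds/theta
lifts: the proofs are analytic, infinite sums, NOT chains), explicit hypergeometric analysis (Zhou).
BruinierLiYang2025 p.5 ask
precisely for the algebraic interpretation ("Z^r(f) should be rationally equivalent to zero … would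
require some non-trivial work,
see Mellit08") and Zhou2015 Remark 6 declines the Chow-group route: compiling the rational
equivalence into moves is unaddressed.
What prior routes do not do: LowDimension/Grothendieck/Neg/ExpConservative test pure or
1-dimensional identities (MZV, beta, Legendre);
this is the first MIXED family (log ⊗ period, weight filtration of length 2) and the first KZ items
whose numerical truth is a 2025 theorem.

RANKED CRUXES. #0 FirstPairs (target) — layer 1 of the sector: (a) the model torsion-biextension
pair on y² = x³+1 (6-torsion pole P = (2,3), arc between the 3-torsion points ∓Q = (0,∓1)):
9∫_{-1}^0 dx/((2−x)√(x³+1)) ≡ [∫_1^2 dx/x] + [∫_{-1}^∞ dx/√(x³+1)] in FormalRep/relations; (b)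
GKZLevelOnePair; (c) GKZLevelThreePair. (why it might fail: (a) is elementary (two changes of
variables + additivity); (b),(c) are the cruxes: no move-chain for any higher-Green-function value
is known, all proofs are analytic or automorphic.) [Zhou2015, BruinierLiYang2025, Zhang1997,
KontsevichZagier2001]
#2 GKZLevelOnePair (crux) — Mellit's case of GKZ (N = 1, z′ = i, z = ρ = e^{iπ/3}), Zhou2015 Remark
9: G₂^{PSL₂ℤ}(ρ, i) = −(8π/3)∫₀¹ P_{-1/6}(ξ)² dξ = −(12/√3) log(2+√3). With Euler's integral
P_{-1/6}(ξ) = (2π)⁻¹ ∫₀¹ t^{-1/6}(1−t)^{-5/6}(1−(1−ξ)t/2)^{-1/6} dt this is the 3-dim period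
identity J₁ := ∫_{(0,1)³} Π_{u∈{t,s}} u^{-1/6}(1−u)^{-5/6}(1−(1−ξ)u/2)^{-1/6} dt ds dξ =
6√3·π·log(2+√3) = vol-integral of 1/w over {(u²+v²)² < 108, 1 < w < 2+√3}. CLAIM: the two
representations are KZ-equivalent. Expected chain: compile Mellit's rational equivalence for the CM
cycle pair on E_ρ × E_i (Kuga–Sato over X(1), rigidified) through RationalEquivalenceActsByMoves,
then a Zhang–Zhou bridge (Eichler-integral manipulations) to Zhou's representation. [difficulty: XL]
(why it might fail: Only analytic proofs exist (Legendre ODE + Gauss digamma; theta lifts). A chain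
must push Mellit's certificate through Stokes on a cut complex surface with log poles, where fibre
integrals are period functions (not admissible primitives); may be a calculus-size counterexample.)
[Zhou2015, BruinierLiYang2025, Zhang1997, GrossZagier1986]
#4 GKZLevelThreePair (crux) — level 3, Zhou2015 Remark 9: G₂^{Γ₀(3)}((3+i√3)/6, i/√3) =
−(2π/(3√3))∫₀¹ P_{-1/3}(ξ)² dξ = −2 log 2; with P_{-1/3}(ξ) = (√3/2π)∫₀¹
t^{-1/3}(1−t)^{-2/3}(1−(1−ξ)t/2)^{-1/3} dt this is J₃ := ∫_{(0,1)³} Π_{u∈{t,s}}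
u^{-1/3}(1−u)^{-2/3}(1−(1−ξ)u/2)^{-1/3} dt ds dξ = 4√3·π·log 2 = integral of 1/w over {(u²+v²)² <
48, 1 < w < 2}. CLAIM: KZ-equivalent. Smallest field of values (log 2 ∈ log ℚ), but NO torsion
certificate for the CM cycles over X₀(3) is in print (needs KugaSatoCertificate) — or compile Zhou's
elementary proof (Legendre ODE integration by parts in ξ; ψ(5/6) − ψ(1/3) = ∫₀¹(t^{-2/3} −
t^{-1/6})/(1−t) dt = 6∫₀¹ u du/(1+u³), partial fractions). [difficulty: XL] (why it might fail: No
rational equivalence for the level-3 CM cycles is known (Beilinson–Bloch open for CH² of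
threefolds); compiling Zhou's proof needs d/dξ under the integral sign (not a move) before the
digamma step; the drop from dimension 3 to log 2 may exceed the calculus.) [Zhou2015,
BruinierLiYang2025, Zhang1997, GrossKohnenZagier1987]
#9 CertificateDlogUnfolds (support) — W-step calibration on E: y² = x³+1 with P = (2,3) of order 6:
F := (y−2x+1)³(y−1)/x³ = (x³+12x²−6x+10) − 6(x+1)y has norm (x−2)⁶ and div F = 6(P) − 6(O); 6·ω_P =
dF/F − 3dx/y for ω_P = (y+3)dx/(2y(x−2)), hence (x+1)dx/((x−2)y) = (1/6) d log(F/F̄). On the arc x ∈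
(−1,0), y = √(x³+1): φ = (g−yh)/(g+yh) decreases from 1 to 1/4, so ONE change of variables s = φ(x)
plus s = x⁻² gives ∫_{-1}^0 (x+1)dx/((2−x)√(x³+1)) = ∫_1^2 dx/(3x) = (log 2)/3 — the certificate's d
log is consumed by rule (2), no primitive needed. [difficulty: provable-now] [KontsevichZagier2001,
Zhang1997]
#9 OneThirdPeriod (support) — Z-step calibration on y² = x³+1: the flex Q = (0,1) is 3-torsion
(tangent y = 1) and translation by Q is the algebraic change of variables x ↦ −2x/(1+√(x³+1)),
mapping (0,2) and (2,∞) each bijectively onto (−1,0) and preserving dx/y (P = (2,3) = T₂ − Q is the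
break point); with two domain-additivity moves: 3∫_{-1}^0 dx/√(x³+1) = ∫_{-1}^∞ dx/√(x³+1)
(classically B(1/3,1/2) = B(1/3,1/6)/2, a Γ-reflection identity — here reached WITHOUT Γ).
[difficulty: provable-now] [KontsevichZagier2001, GrossZagier1986]

TWO-LAYER PLAN. Foreseen splits, filed only when a crux moves: GKZLevelOnePair ⇐
KugaSatoCertificateLevelOne (Mellit's rational equivalence for
(E_ρ × E_i, CM graph cycles) written as explicit (C_i, f_i)) → CompiledCertificate
(RationalEquivalenceActsByMoves instance:
N·[biextension rep] ≡ [log|α| rep] + [pure period of the Kuga–Sato surface pair]) → ZhangZhouBridge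
(Zhou's J₁-representation ≡ the
biextension representation: Eichler-integral/Legendre–Ramanujan manipulations as moves, handed to
the limit/regularisation cards where
Zhou renormalises) → GKZLevelOnePair. GKZLevelThreePair ⇐ same three children at level 3
(certificate = KugaSatoCertificate, open).
RationalEquivalenceActsByMoves ⇐ TraceIsAMove (rule (2) per branch + rule (1b): Σ branches = f_*ω) →
SemialgebraicStokesCutSurface
(homologous semialgebraic (2d+1)-cycles on C_i(ℂ) cut along f⁻¹(ray) give equivalent reps; shared
need with NoriTransfer rank 2) →
RayLogUnfolding (∫₀^∞ Σ m_j dt/(t+a_j), Σm_j = 0, ≡ −Σ m_j[log a_j] via the 2-dim band ∫∫ds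
dt/(t+s)²) → RationalEquivalenceActsByMoves.

KILL CRITERIA. Refutation of GKZLevelOnePair or GKZLevelThreePair = an additive invariant FormalRep
→+ A killing the four move sets and separating the
pair ⇒ ¬KontsevichZagierPeriods outright (values agree: Zhou2015 Remark 9, and
KZ.exists_isRational_equivalent moves the algebraic
side to rational shape): close `refuted:<Decl>`, hand the witness to route Neg as its first
theorem-backed counterexample. Refutation
of a support item ⇒ a defect of the fixed calculus (two-move paper proofs exist): report to
operator. KugaSatoCertificate refuted at
levels 2–3 (CM cycles provably non-torsion) ⇒ pivot: the compiled-certificate mechanism has no input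
there; keep level 1 (Mellit) and
re-rank GKZLevelThreePair behind a 'compile Zhou's analytic proof' child. A general theorem
'Clausen/hypergeometric identities at
rational parameters are chains' proved elsewhere (two-route-hypergeometric-transport card) would
moot ranks 2/4 as tests of THIS
mechanism (supersede the layer, keep RationalEquivalenceActsByMoves).

NOT DECOMPOSED YET. Family statements (all CM pairs on X₀(N), N ≤ 4, weights 4/6/8 = Zhou2015 Thm
1.2.1; general f of BruinierLiYang2025 Conj 1.1) —
need definitions (higher Green function, CM points, Zhou representations as named facts); the
level-2 pair (J₂ ∝ π√2·log(1+√2));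
the Zhang–Zhou bridge; semialgebraic chains on X(ℂ) and Stokes (shared with NoriTransfer,
riemann-bilinear/lefschetz cards: file once,
not here); the schema version of the support items (all elliptic curves over ℚ, all torsion
certificates (g,h,κ,μ) with g² − c h² =
κ(X−a)^N: third-kind rep ≡ log rep + μ·first-kind rep by one change of variables; arcs between real
torsion points tile the real period)
— provable with effort, filed as children only if a prover wants them; the negations ¬GKZLevel*Pair
(Neg's invariant hunt; refuters
attack the items anyway); no Beilinson–Bloch named fact (nothing filed is conditional on it).

CHEAPEST FALSIFIER. (1) Numerics to 30 digits of J₃ = 4√3·π·log 2 ≈ 15.0868 and J₁ = 6√3·π·log(2+√3)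
≈ 42.997 against the triple integrals, and of the
model pair 9∫_{-1}^0 dx/((2−x)√(x³+1)) = log 2 + 3·(1/3)B(1/3,1/2) ≈ 0.693147 + 4.206546 (script
compute/check1.py in the planner
folder; the kit socket was absent at filing, so a grounder should run it FIRST). By hand (done):
Zhou's closed form π∫₀¹P_ν² =
π/(2ν+1)·{1 + (sin νπ/π)[ψ((ν+2)/2) − ψ((ν+1)/2)]} re-evaluated at ν = −1/3, −1/4, −1/6 with Gauss's
digamma theorem reproduces his three
displayed CM values (3√3 log 2, 4 log(1+√2), (3√3/2) log(2+√3)); F, its norm (x−2)⁶, μ = −3 and d/dx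
log(F/F̄) = 6(x+1)/((x−2)y)
checked by direct expansion; x′ = −2x/(1+√(x³+1)) from the addition law. (2) Lookup: does Mellit08
give the rational equivalence for
z = ρ explicitly (then rank 2's first child is transcription, not research)?

NUMBERS. J₃ = 4√3π log 2 ≈ 15.0868; J₁ = 6√3π log(2+√3) ≈ 42.997; K₁ = ∫_{-1}^0 dx/√(x³+1) =
(1/3)B(1/3,1/2) ≈ 1.402182 = Ω₀/3, Ω₀ = ∫_{-1}^∞
≈ 4.206546; ∫_{-1}^0 (x+1)dx/((2−x)√(x³+1)) = (log 2)/3 ≈ 0.231049; GKZ constants: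
G₂^{Γ₀(3)}((3+i√3)/6, i/√3) = −2 log 2,
G₂^{PSL₂ℤ}(ρ,i) = −(12/√3) log(2+√3), G₂^{Γ₀(2)}((i−1)/2, i/√2) = −(4/√2) log(1+√2) (Zhou2015 Remark
9). Torsion data on y² = x³+1:
E(ℚ)_tors = ℤ/6 = ⟨(2,3)⟩, 2P = (0,1), 3P = (−1,0). Items at open: 6 typed + 2 informal cruxes = 8.

DEFINITION REQUESTS. (d1) `higherGreenFunctionCM` (Literature/NumberTheory/Automorphic):
G_k^{Γ₀(N)}(z₁,z₂) (GrossZagier1986 §V.? resolvent-kernel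
definition), CM points of discriminant d, with named facts: Zhou2015 Thm 1.2.1/Prop 2.2.2 (KZ
integral representations, cusp-form-free
levels) and Remark 9 (the three evaluations); BruinierLiYang2025 Thm 1.4 (`gkzAlgebraicity`: Conj
1.1 holds); Zhang1997 (G_k CM value =
archimedean height of CM cycles). (d2) semialgebraic singular chains on X(ℂ) ⊂ ℝ^{2n} and their KZ
representations (shared with
NoriTransfer; not re-filed here). Cite facts filed after open.

Novelty: Searches (2026-08-15): `lit search "Gross Kohnen Zagier conjecture higher Green functions" --source
crossref` (15 rows: Borcherds 1999,
Xue 2010, Zemel 2015, Yuan–Zhang–Zhang 2009, BruinierLiYang2025 = doi:10.1017/fms.2024.139 …); `lit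
read arXiv:2204.10604` pp.3–5 READ
(Conj 1.1 proved, Thm 1.4; p.5 asks for the algebraic/rational-equivalence interpretation); `lit
read arXiv:1312.6352` (Zhou2015) pp.3–7,
15–19 READ (Thm 1.2.1, Remark 6 declining the Chow-group route, Remark 9 evaluations); `lit search …
--source crossref` for Zhou II
(doi:10.1007/s11139-016-9818-9) and erratum (doi:10.1007/s11139-018-0100-1); `lit frontier
KontsevichZagierPeriods --since 2020` (30 rows,
MZV/odd-zeta/Nori — nothing on heights or Green functions); `lit bridges KontsevichZagierPeriods
--cross any` (BSD crossings only via
GrossZagier1986 in surveys); `lit galaxy search "Higher Green's functions for modular forms Mellit"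
--star all` (galaxyd queued > 90 s,
0 rows); openalex 429. The 120-card index of the summit: no other card on heights/biextensions/GKZ
(triage-5 confirmed uniqueness).
Nearest prior art found: Zhou2015 (+ Part II doi:10.1007/s11139-016-9818-9): writes G_k CM values as
KZ periods and evaluates three
analytically, explicitly leaving the Chow-group approach aside (Remark 6); Mellit 2008 (Bonn thesis,
cited via BruinierLiYang2025/Zhou2015):
geometric proof of algebraicity for N = 1, z′ = i — rational equivalences, no rules;
BruinierLiYang2025: automorphic proof of the whole
conjectur  [refs: 10.1017/fms.2024.139, 10.1007/s11139-016-9818-9, 10.1007/s11139-018-0100-1, 2204.10604, 1312.6352, doi:10.1017/fms.2024.139, doi:10.1007/s11139-016-9818-9, doi:10.1007/s11139-018-0100-1, BruinierLiYang2025, Zhou2015, GrossZagier1986]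

Barriers (technique_class: rational-equivalence-transfer mixed-regulator log-unfolding): - technique_class: rational-equivalence-transfer mixed-regulator log-unfolding
- Literature.Barriers.KontsevichZagierPeriods.noSemialgebraicPrimitive_inv_sub_two: evaded in layer
1 — logs enter only as the representation ∫dt/t and the certificate's d log F is consumed by the
change of variables s = F (CertificateDlogUnfolds), never as a primitive; CONCEDED one dimension up:
in codimension ≥ 2 the fibre integrals f_*ω are period functions, so 'integrate out t' is exactly
this barrier's class — RationalEquivalenceActsByMoves must replace it by Stokes on the cut surface
(the bet).
- Literature.Barriers.KontsevichZagierPeriods.kzConjecture_implies_twoPiI_log_algIndep: respected by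
scope (strength barrier, with kzConjecture_implies_oddZetaAlgIndep / _ellipticPeriods_algIndep): the
route derives only identities that are theorems (Zhou2015 Remark 9, BruinierLiYang2025, beta
identities) and claims no independence statement and no route to the summit.
- Literature.Barriers.KontsevichZagierPeriods.cressonViuSos_prop_3_2: not engaged — every step uses
dissection (rule 1) and several changes of variables on cells, never one global map between the two
representations.
- Literature.Barriers.KontsevichZagierPeriods.not_complete_of_undecidable: not engaged (conditional
barrier on completeness of the whole calculus; the route asserts accessibility of specific pairs
only).
- Negatives index: empty for this summit at filing (ledger negatives, 2026-08-15).

Novelty grade: new-combination — RREVIEW 2026-08-15 (full text + numerics: evidence gkz_evidence.py / REVIEW_R2.md on 4039-4041). ELAB: 5/5 decls + Assembly rc0. NON-VACUOUS: J1/J3 integrands algebraic (y^6 * poly = 1), domains Q-definable (1<w<2+sqrt3 iff 1<w and (w<2 or (w-2)^2<3)), integrable => reps exist; forall-(r,r') form == (refuter refuter-rreview-route-Schanuel-Arithmeti-73a061ab-0, 2026-08-15T13:49:27Z; prior: Zhou2015 arXiv:1312.6352 (Thm 1.2.1, Rem. 6, Rem. 9); BruinierLiYang2025 doi:10.1017/fms.2024.139;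 Mellit 2008 (Bonn thesis); GrossZagier1986 §V; KontsevichZagier2001 §1.2)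

History (route lifecycle, newest last):
- 2026-08-15T13:48:38Z · CLOSED retired — not-a-thesis: assembly does not conclude the sub-problem Statement (operator:999:1257524)

sub-problem: KontsevichZagierPeriods · status: closed(retired) · opened planner-plancard-KontsevichZagierPeriods-Kont-cea0fcd2-0 2026-08-15T11:27:08Z · rev 0 · ledger route-KontsevichZagierPeriods-TorsionLogsGKZ
GENERATED by the gate from the ledger (D-0016/17). Provers cite these decls: `theorem foo : Summit.KontsevichZagierPeriods.KontsevichZagierPeriods.Theses.TorsionLogsGKZ.<Decl> := …` in Summits/KontsevichZagierPeriods/KontsevichZagierPeriods/Theorems/<Name>.lean.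
-/

namespace Summit.KontsevichZagierPeriods.KontsevichZagierPeriods.Theses.TorsionLogsGKZ

open scoped BigOperators Topology Manifold Classical MeasureTheory ProbabilityTheory Matrix InnerProductSpace ComplexConjugate ContinuousMap
open Filter Set Function TopologicalSpace MeasureTheory

attribute [summit_statement] _root_.KontsevichZagierPeriods

open Literature Periods

/-- item stmt-KontsevichZagierPeriods-4039 · target · rank 0 · closed · moot by None · by planner
why it might fail: (a) is elementary (two changes of variables + additivity); (b),(c) are the cruxes: no move-chain for any higher-Green-function value is known, all proofs are analytic or automorphic.
sources: Zhou2015, BruinierLiYang2025, Zhang1997, KontsevichZagier2001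
[target] layer 1 of the sector: (a) the model torsion-biextension pair on y² = x³+1 (6-torsion pole
P = (2,3), arc between the 3-torsion points ∓Q = (0,∓1)): 9∫_{-1}^0 dx/((2−x)√(x³+1)) ≡ [∫_1^2 dx/x]
+ [∫_{-1}^∞ dx/√(x³+1)] in FormalRep/relations; (b) GKZLevelOnePair; (c) GKZLevelThreePair. -/
@[route_item "route-KontsevichZagierPeriods-TorsionLogsGKZ"]
def FirstPairs : Prop :=
  (∀ (r r₁ r₂ : Literature.NumberTheory.Transcendental.KZ.IntegralRep 1), r.domain = {x | x 0 ∈ Set.Ioo (-1:ℝ) 0} → Set.EqOn r.integrand (fun x => 9 / ((2 - x 0) * Real.sqrt (x 0 ^ 3 + 1))) r.domain → r₁.domain = {x | x 0 ∈ Set.Ioo (1:ℝ) 2} → Set.EqOn r₁.integrand (fun x => 1 / x 0) r₁.domain → r₂.domain = {x | -1 < x 0} → Set.EqOn r₂.integrand (fun x => 1 / Real.sqrt (x 0 ^ 3 + 1)) r₂.domain → Literature.NumberTheory.Transcendental.KZ.of r - Literature.NumberTheory.Transcendental.KZ.of r₁ - Literature.NumberTheory.Transcendental.KZ.of r₂ ∈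 Literature.NumberTheory.Transcendental.KZ.relations) ∧ (∀ (r r' : Literature.NumberTheory.Transcendental.KZ.IntegralRep 3), r.domain = {x | ∀ i, x i ∈ Set.Ioo (0:ℝ) 1} → Set.EqOn r.integrand (fun x => (x 0) ^ (-(1:ℝ) / 6) * (1 - x 0) ^ (-(5:ℝ) / 6) * (1 - (1 - x 2) * x 0 / 2) ^ (-(1:ℝ) / 6) * ((x 1) ^ (-(1:ℝ) / 6) * (1 - x 1) ^ (-(5:ℝ) / 6) * (1 - (1 - x 2) * x 1 / 2) ^ (-(1:ℝ) / 6))) r.domain → r'.domain = {x | (x 0 ^ 2 + x 1 ^ 2) ^ 2 < 108 ∧ x 2 ∈ Set.Ioo (1:ℝ) (2 + Real.sqrt 3)} → Set.EqOn r'.integrand (fun x => 1 / x 2) r'.domain → Literature.NumberTheory.Transcendental.KZ.Equivalent r r') ∧ (∀ (r r' : Literature.NumberTheory.Transcendental.KZ.IntegralRep 3), r.domain = {x | ∀ i, x i ∈ Set.Ioo (0:ℝ) 1} → Set.EqOn r.integrand (fun x => (x 0) ^ (-(1:ℝ) / 3) * (1 - x 0) ^ (-(2:ℝ) / 3) * (1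 - (1 - x 2) * x 0 / 2) ^ (-(1:ℝ) / 3) * ((x 1) ^ (-(1:ℝ) / 3) * (1 - x 1) ^ (-(2:ℝ) / 3) * (1 - (1 - x 2) * x 1 / 2) ^ (-(1:ℝ) / 3))) r.domain → r'.domain = {x | (x 0 ^ 2 + x 1 ^ 2) ^ 2 < 48 ∧ x 2 ∈ Set.Ioo (1:ℝ) 2} → Set.EqOn r'.integrand (fun x => 1 / x 2) r'.domain → Literature.NumberTheory.Transcendental.KZ.Equivalent r r')

/-- item stmt-KontsevichZagierPeriods-4040 · crux · rank 2 · closed · moot by None · by planner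
why it might fail: Only analytic proofs exist (Legendre ODE + Gauss digamma; theta lifts). A chain must push Mellit's certificate through Stokes on a cut complex surface with log poles, where fibre integrals are period functions (not admissible primitives); may be a calculus-size counterexample.
sources: Zhou2015, BruinierLiYang2025, Zhang1997, GrossZagier1986
[crux] Mellit's case of GKZ (N = 1, z′ = i, z = ρ = e^{iπ/3}), Zhou2015 Remark 9: G₂^{PSL₂ℤ}(ρ, i) =
−(8π/3)∫₀¹ P_{-1/6}(ξ)² dξ = −(12/√3) log(2+√3). With Euler's integral P_{-1/6}(ξ) = (2π)⁻¹ ∫₀¹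
t^{-1/6}(1−t)^{-5/6}(1−(1−ξ)t/2)^{-1/6} dt this is the 3-dim period identity J₁ := ∫_{(0,1)³}
Π_{u∈{t,s}} u^{-1/6}(1−u)^{-5/6}(1−(1−ξ)u/2)^{-1/6} dt ds dξ = 6√3·π·log(2+√3) = vol-integral of 1/w
over {(u²+v²)² < 108, 1 < w < 2+√3}. CLAIM: the two representations are KZ-equivalent. Expected
chain: compile Mellit's rational equivalence for the CM cycle pair on E_ρ × E_i (Kuga–Sato over
X(1), rigidified) through RationalEquivalenceActsByMoves, then a Zhang–Zhou bridge (Eichler-integral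
manipulations) to Zhou's representation. [difficulty: XL] -/
@[route_item "route-KontsevichZagierPeriods-TorsionLogsGKZ"]
def GKZLevelOnePair : Prop :=
  ∀ (r r' : Literature.NumberTheory.Transcendental.KZ.IntegralRep 3), r.domain = {x | ∀ i, x i ∈ Set.Ioo (0:ℝ) 1} → Set.EqOn r.integrand (fun x => (x 0) ^ (-(1:ℝ) / 6) * (1 - x 0) ^ (-(5:ℝ) / 6) * (1 - (1 - x 2) * x 0 / 2) ^ (-(1:ℝ) / 6) * ((x 1) ^ (-(1:ℝ) / 6) * (1 - x 1) ^ (-(5:ℝ) / 6) * (1 - (1 - x 2) * x 1 / 2) ^ (-(1:ℝ) / 6))) r.domain → r'.domain = {x | (x 0 ^ 2 + x 1 ^ 2) ^ 2 < 108 ∧ x 2 ∈ Set.Ioo (1:ℝ) (2 + Real.sqrt 3)} → Set.EqOn r'.integrand (fun x => 1 / x 2) r'.domain → Literature.NumberTheory.Transcendental.KZ.Equivalent r r'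

/-- item stmt-KontsevichZagierPeriods-4041 · crux · rank 4 · closed · moot by None · by planner
why it might fail: No rational equivalence for the level-3 CM cycles is known (Beilinson–Bloch open for CH² of threefolds); compiling Zhou's proof needs d/dξ under the integral sign (not a move) before the digamma step; the drop from dimension 3 to log 2 may exceed the calculus.
sources: Zhou2015, BruinierLiYang2025, Zhang1997, GrossKohnenZagier1987
[crux] level 3, Zhou2015 Remark 9: G₂^{Γ₀(3)}((3+i√3)/6, i/√3) = −(2π/(3√3))∫₀¹ P_{-1/3}(ξ)² dξ = −2
log 2; with P_{-1/3}(ξ) = (√3/2π)∫₀¹ t^{-1/3}(1−t)^{-2/3}(1−(1−ξ)t/2)^{-1/3} dt this is J₃ :=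
∫_{(0,1)³} Π_{u∈{t,s}} u^{-1/3}(1−u)^{-2/3}(1−(1−ξ)u/2)^{-1/3} dt ds dξ = 4√3·π·log 2 = integral of
1/w over {(u²+v²)² < 48, 1 < w < 2}. CLAIM: KZ-equivalent. Smallest field of values (log 2 ∈ log ℚ),
but NO torsion certificate for the CM cycles over X₀(3) is in print (needs KugaSatoCertificate) — or
compile Zhou's elementary proof (Legendre ODE integration by parts in ξ; ψ(5/6) − ψ(1/3) =
∫₀¹(t^{-2/3} − t^{-1/6})/(1−t) dt = 6∫₀¹ u du/(1+u³), partial fractions). [difficulty: XL] -/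
@[route_item "route-KontsevichZagierPeriods-TorsionLogsGKZ"]
def GKZLevelThreePair : Prop :=
  ∀ (r r' : Literature.NumberTheory.Transcendental.KZ.IntegralRep 3), r.domain = {x | ∀ i, x i ∈ Set.Ioo (0:ℝ) 1} → Set.EqOn r.integrand (fun x => (x 0) ^ (-(1:ℝ) / 3) * (1 - x 0) ^ (-(2:ℝ) / 3) * (1 - (1 - x 2) * x 0 / 2) ^ (-(1:ℝ) / 3) * ((x 1) ^ (-(1:ℝ) / 3) * (1 - x 1) ^ (-(2:ℝ) / 3) * (1 - (1 - x 2) * x 1 / 2) ^ (-(1:ℝ) / 3))) r.domain → r'.domain = {x | (x 0 ^ 2 + x 1 ^ 2) ^ 2 < 48 ∧ x 2 ∈ Set.Ioo (1:ℝ) 2} → Set.EqOn r'.integrand (fun x => 1 / x 2) r'.domain → Literature.NumberTheory.Transcendental.KZ.Equivalent r r'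

-- item stmt-KontsevichZagierPeriods-4444 · support · rank 3 · closed · moot by None · by planner — informal only, no Lean statement yet:
--   [crux] RATIONAL EQUIVALENCE ACTS BY MOVES (the engine; card torsion-extensions-compile-to-logs-gkz,
--   claim X1). Data: X smooth projective over ℚ̄ (real and imaginary parts of coordinates make X(ℂ) ⊂
--   ℝ^{2n} ℚ-semialgebraic); Z a d-dimensional algebraic cycle homologous to 0 with an EXPLICIT torsion
--   certificate N·Z = Σ_i div(f_i), f_i ∈ ℚ̄(C_i)^×, C_i ⊂ X subvarieties of dimension d+1; Γ a
--   ℚ-semialgebraic (2d+1)-chain on X(ℂ) with ∂Γ = Z; ω a closed algebraic (2d+1)-form on X minus a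
--   cycle W disjoint from Z (log poles along W; M·W = Σ div g_j a second certificate when W is torsion
--   too). CLAIM: in

-- item stmt-KontsevichZagierPeriods-4454 · support · rank 5 · closed · moot by None · by planner — informal only, no Lean statement yet:
--   [crux] KUGA–SATO TORSION CERTIFICATES (the input of the engine for the GKZ family). For the three
--   cusp-form-free weight-4 CM pairs of Zhou2015 Remark 9 — (N, z, z′) = (1, (1+i√3)/2, i), (2, (i−1)/2,
--   i/√2), (3, (3+i√3)/6, i/√3) — the modified CM cycles S(z), S(z′) of Zhang1997 §§0–3 (graphs of
--   complex multiplication in the fibre E_τ × E_τ of the Kuga–Sato threefold W(N) → X₀(N), corrected by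
--   horizontal/vertical fibres and boundary components to be homologous to zero; for N = 1 use a
--   rigidifying auxiliary level and descend) are TORSION in CH²(W(N))_hom, with an EXPLICIT rational
--   equivalence n·S(

/-- item stmt-KontsevichZagierPeriods-4042 · support · rank 9 · closed · moot by None · by planner
sources: KontsevichZagier2001, Zhang1997
[support] W-step calibration on E: y² = x³+1 with P = (2,3) of order 6: F := (y−2x+1)³(y−1)/x³ =
(x³+12x²−6x+10) − 6(x+1)y has norm (x−2)⁶ and div F = 6(P) − 6(O); 6·ω_P = dF/F − 3dx/y for ω_P =
(y+3)dx/(2y(x−2)), hence (x+1)dx/((x−2)y) = (1/6) d log(F/F̄). On the arc x ∈ (−1,0), y = √(x³+1): φ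
= (g−yh)/(g+yh) decreases from 1 to 1/4, so ONE change of variables s = φ(x) plus s = x⁻² gives
∫_{-1}^0 (x+1)dx/((2−x)√(x³+1)) = ∫_1^2 dx/(3x) = (log 2)/3 — the certificate's d log is consumed by
rule (2), no primitive needed. [difficulty: provable-now] -/
@[route_item "route-KontsevichZagierPeriods-TorsionLogsGKZ"]
def CertificateDlogUnfolds : Prop :=
  ∀ (r r' : Literature.NumberTheory.Transcendental.KZ.IntegralRep 1), r.domain = {x | x 0 ∈ Set.Ioo (-1:ℝ) 0} → Set.EqOn r.integrand (fun x => (x 0 + 1) / ((2 - x 0) * Real.sqrt (x 0 ^ 3 + 1))) r.domain → r'.domain = {x | x 0 ∈ Set.Ioo (1:ℝ) 2} → Set.EqOn r'.integrand (fun x => 1 / (3 * x 0)) r'.domain → Literature.NumberTheory.Transcendental.KZ.Equivalent r r'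

/-- item stmt-KontsevichZagierPeriods-4043 · support · rank 9 · closed · moot by None · by planner
sources: KontsevichZagier2001, GrossZagier1986
[support] Z-step calibration on y² = x³+1: the flex Q = (0,1) is 3-torsion (tangent y = 1) and
translation by Q is the algebraic change of variables x ↦ −2x/(1+√(x³+1)), mapping (0,2) and (2,∞)
each bijectively onto (−1,0) and preserving dx/y (P = (2,3) = T₂ − Q is the break point); with two
domain-additivity moves: 3∫_{-1}^0 dx/√(x³+1) = ∫_{-1}^∞ dx/√(x³+1) (classically B(1/3,1/2) =
B(1/3,1/6)/2, a Γ-reflection identity — here reached WITHOUT Γ). [difficulty: provable-now] -/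
@[route_item "route-KontsevichZagierPeriods-TorsionLogsGKZ"]
def OneThirdPeriod : Prop :=
  ∀ (r r' : Literature.NumberTheory.Transcendental.KZ.IntegralRep 1), r.domain = {x | x 0 ∈ Set.Ioo (-1:ℝ) 0} → Set.EqOn r.integrand (fun x => 3 / Real.sqrt (x 0 ^ 3 + 1)) r.domain → r'.domain = {x | -1 < x 0} → Set.EqOn r'.integrand (fun x => 1 / Real.sqrt (x 0 ^ 3 + 1)) r'.domain → Literature.NumberTheory.Transcendental.KZ.Equivalent r r'

/-- item stmt-KontsevichZagierPeriods-4044 · assembly · rank 1 · closed · moot by None · by planner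
sources: KontsevichZagier2001, Zhou2015
[assembly] GKZLevelOnePair → GKZLevelThreePair → CertificateDlogUnfolds → OneThirdPeriod →
FirstPairs. -/
@[route_item "route-KontsevichZagierPeriods-TorsionLogsGKZ"]
def Assembly : Prop :=
  GKZLevelOnePair → GKZLevelThreePair → CertificateDlogUnfolds → OneThirdPeriod → FirstPairs

end Summit.KontsevichZagierPeriods.KontsevichZagierPeriods.Theses.TorsionLogsGKZ
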